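import Literature.AlgebraicGeometry.Frobenioids.EquivalenceGroupLikeQuasiIsotropic
import Literature.AlgebraicGeometry.Frobenioids.EquivalenceDegreesGroupLike
import HarnessLib

/-!
# Frobenioids I, Theorem 3.4 (iii) AS TYPED over bases of FSM-type, and the degree clause of
# Theorem 3.4 (iv) modulo the unit clause — assembly of the group-like / non-group-like dichotomy

Mochizuki, *The geometry of Frobenioids I: the general theory*, Kyushu J. Math. **62** (2008)
293–400, Thm. 3.4 (iii)/(iv), kurims pp. 62–63; proof pp. 64–67 [cite: MochizukiFrdI2008, Thm. 3.4 (iii) p.62].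
The printed proof of (iii)/(iv) splits into "`C₁`, `C₂` not of group-like type" (p. 64: "which is
equal to `p₁` if `C₁`, `C₂` are not of group-like type"; p. 66: "If `C₁`, `C₂` are not of group-like
type, then this already follows formally from assertion (iii)") and "`C₁`, `C₂` of group-like type"
(p. 65 ll. 6–12; p. 66 l. 42 – p. 67 l. 21). This PROOF-ONLY file (abc-iut cell, seat abc-iut-w4-d033;
sub-DAG `plan/L1/SUBDAG-FrdI-Thm34.md`, rows `(iii)/L00 Assembly_iii` reading and `(iv)/L09`) assembles
the two cases, both of which are in the tree:

* non-group-like objects on both sides: abc-iut-L1-t13's `FrdI.thm34iii_morphisms_of_isOfFSMType` /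
  `FrdI.degFr_map` (bases of FSM-type — the cell's repaired reading of print's "FSMFF-type", residual
  R2 of `plan/GAP-LEDGER.md`);
* group-like type on both sides: abc-iut-w4-d088's `FrdI.thm34iii_of_isOfGroupLikeType_of_hypB`
  (p412406; independently abc-iut-w4-d033, staged) and abc-iut-w4-d033's
  `FrdI.preservesDegFr_ofFunctor_of_isOfGroupLikeType` (p412396, via a Frobenius-compact object);
* the dichotomy itself (`FrdI.groupLike_dichotomy_of_isOfFSMType`): `Ψ` and `Ψ⁻¹` carry group-like
  objects to group-like objects (Thm. 3.4 (ii), abc-iut-L1-t13's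
  `FrdI.isGroupLikeObj_map_of_quasiIsotropic_of_isOfFSMType`), so either both Frobenioids are of
  group-like type or both admit a non-group-like object.

Results: `FrdI.thm34iii_ofFunctor_of_isOfFSMType` — the typed statement `PreFrobenioidData.Thm34iii`
(abc-iut-L1-t3, `BaseCategoryTheoreticity.lean`) HOLDS for every pair of Frobenioids `C_i → F_{Φ_i}` over
bases of FSM-type (through the adapter `PreFrobenioidData.ofFunctor`); and
`FrdI.preservesDegFr_ofFunctor_of_isOfFSMType` — the clause "`Ψ^{ℕ≥1}` is the identity" of
`PreFrobenioidData.Thm34iv` over bases of FSM-type, modulo ONLY the clause "`Ψ` preserves `O^×(−)`" of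
the same theorem (sub-DAG row `(iv)/L08`, by name as `hU`). No statement of the paper is restated as a
`Prop` or strengthened; nothing here bears on the disputed [IUTchIII] Cor. 3.12.
-/

namespace Literature.AlgebraicGeometry.Frobenioids

namespace FrdI

open CategoryTheory PreFrobenioidData

universe w v v' u u'

variable {D₁ : Type u} [Category.{v} D₁] {Φ₁ : D₁ᵒᵖ ⥤ CommMonCat.{w}} {C₁ : Type u'} [Category.{v'} C₁]
  {D₂ : Type u} [Category.{v} D₂] {Φ₂ : D₂ᵒᵖ ⥤ CommMonCat.{w}} {C₂ : Type u'} [Category.{v'} C₂]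
  {F₁ : C₁ ⥤ ElemFrobenioid Φ₁} {F₂ : C₂ ⥤ ElemFrobenioid Φ₂}

/-- **Dichotomy.** For Frobenioids of quasi-isotropic type over bases of FSM-type and an equivalence
`Ψ`, either both `C₁`, `C₂` are of group-like type or both admit a non-group-like object (`Ψ`, `Ψ⁻¹`
preserve group-like objects, Thm. 3.4 (ii)). [cite: MochizukiFrdI2008, Thm. 3.4 (ii) p.62] -/
theorem groupLike_dichotomy_of_isOfFSMType (hF₁ : PreFrobenioid.IsFrobenioid F₁)
    (hF₂ : PreFrobenioid.IsFrobenioid F₂) (hq₁ : (ofFunctor Φ₁ F₁).IsOfQuasiIsotropicType)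
    (hq₂ : (ofFunctor Φ₂ F₂).IsOfQuasiIsotropicType) (hD₁ : IsOfFSMType D₁) (hD₂ : IsOfFSMType D₂)
    (Ψ : C₁ ≌ C₂) :
    ((ofFunctor Φ₁ F₁).IsOfGroupLikeType ∧ (ofFunctor Φ₂ F₂).IsOfGroupLikeType) ∨
      ((∃ A : C₁, ¬ (ofFunctor Φ₁ F₁).IsGroupLikeObj A) ∧ ∃ A : C₂, ¬ (ofFunctor Φ₂ F₂).IsGroupLikeObj A) := by
  -- reflection of group-likeness along `Ψ` and `Ψ⁻¹`
  have r₁ : ∀ A : C₁, (ofFunctor Φ₂ F₂).IsGroupLikeObj (Ψ.functor.obj A) → (ofFunctor Φ₁ F₁).IsGroupLikeObj A :=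
    fun A hA => (ofFunctor_isGroupLikeObj F₁ A).2
      (PreFrobenioid.IsGroupLikeObj.of_iso F₁ (Ψ.unitIso.app A).symm
        (isGroupLikeObj_map_of_quasiIsotropic_of_isOfFSMType hF₂ hF₁ hq₂ hq₁ hD₂ Ψ.symm
          ((ofFunctor_isGroupLikeObj F₂ _).1 hA)))
  have r₂ : ∀ B : C₂, (ofFunctor Φ₁ F₁).IsGroupLikeObj (Ψ.inverse.obj B) → (ofFunctor Φ₂ F₂).IsGroupLikeObj B :=
    fun B hB => (ofFunctor_isGroupLikeObj F₂ B).2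
      (PreFrobenioid.IsGroupLikeObj.of_iso F₂ (Ψ.counitIso.app B)
        (isGroupLikeObj_map_of_quasiIsotropic_of_isOfFSMType hF₁ hF₂ hq₁ hq₂ hD₁ Ψ
          ((ofFunctor_isGroupLikeObj F₁ _).1 hB)))
  by_cases hg : (ofFunctor Φ₁ F₁).IsOfGroupLikeType ∧ (ofFunctor Φ₂ F₂).IsOfGroupLikeType
  · exact Or.inl hg
  · right
    rw [not_and_or, PreFrobenioidData.isOfGroupLikeType_iff, PreFrobenioidData.isOfGroupLikeType_iff,
      not_forall, not_forall] at hg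
    rcases hg with ⟨A, hA⟩ | ⟨B, hB⟩
    · exact ⟨⟨A, hA⟩, ⟨Ψ.functor.obj A, fun h' => hA (r₁ A h')⟩⟩
    · exact ⟨⟨Ψ.inverse.obj B, fun h' => hB (r₂ B h')⟩, ⟨B, hB⟩⟩

/-- **Theorem 3.4 (iii) AS TYPED (`PreFrobenioidData.Thm34iii`) holds for Frobenioids over bases of
FSM-type**: (a) standard type, (b) `HypB` ⟹ the seven preservation clauses and the automorphism
`Ψ^{ℕ≥1}` (the identity as soon as non-group-like objects exist). Non-group-like case: abc-iut-L1-t13;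
group-like case: abc-iut-w4-d088 / abc-iut-w4-d033; dichotomy above. Of standard type only (a)
quasi-isotropic and (e) non-dilating are used; "FSM-type" replaces print's (d) "FSMFF-type" (residual R2).
[cite: MochizukiFrdI2008, Thm. 3.4 (iii) p.62] -/
theorem thm34iii_ofFunctor_of_isOfFSMType (hF₁ : PreFrobenioid.IsFrobenioid F₁)
    (hF₂ : PreFrobenioid.IsFrobenioid F₂) (hD₁ : IsOfFSMType D₁) (hD₂ : IsOfFSMType D₂) (Ψ : C₁ ≌ C₂) :
    (ofFunctor Φ₁ F₁).Thm34iii (ofFunctor Φ₂ F₂) Ψ := fun hs₁ hs₂ hB => by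
  rcases groupLike_dichotomy_of_isOfFSMType hF₁ hF₂ hs₁.quasiIsotropic hs₂.quasiIsotropic hD₁ hD₂ Ψ with
    ⟨hg₁, hg₂⟩ | ⟨hN₁, hN₂⟩
  · exact thm34iii_of_isOfGroupLikeType_of_hypB hF₁ hF₂ hs₁.quasiIsotropic hs₂.quasiIsotropic hg₁ hg₂ Ψ hB
  · obtain ⟨hlist, ΨN, hΨN, hid⟩ := thm34iii_morphisms_of_isOfFSMType hF₁ hF₂ hs₁.quasiIsotropic
      hs₂.quasiIsotropic hD₁ hD₂ hs₁.nonDilating hs₂.nonDilating Ψ hN₁ hN₂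
    exact ⟨hlist, ΨN, hΨN, fun _ _ => hid⟩

/-- **Theorem 3.4 (iv), the clause "`Ψ^{ℕ≥1}` is the identity", over bases of FSM-type, modulo the clause
"`Ψ` preserves `O^×(−)`" of the same theorem** (`hU`, sub-DAG row `(iv)/L08`): under (a) standard type and
(b) `HypB`, `Ψ` preserves all Frobenius degrees. Non-group-like case: abc-iut-L1-t13's `FrdI.degFr_map`
("this already follows formally from assertion (iii)"); group-like case: the Frobenius-compact argument
`FrdI.preservesDegFr_ofFunctor_of_isOfGroupLikeType` fed with abc-iut-w4-d088's automorphism `Ψ^{ℕ≥1}`.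
[cite: MochizukiFrdI2008, Thm. 3.4 (iv) p.63] -/
theorem preservesDegFr_ofFunctor_of_isOfFSMType (hF₁ : PreFrobenioid.IsFrobenioid F₁)
    (hF₂ : PreFrobenioid.IsFrobenioid F₂) (hD₁ : IsOfFSMType D₁) (hD₂ : IsOfFSMType D₂) (Ψ : C₁ ≌ C₂)
    (hs₁ : (ofFunctor Φ₁ F₁).IsOfStandardType) (hs₂ : (ofFunctor Φ₂ F₂).IsOfStandardType)
    (hB : (ofFunctor Φ₁ F₁).HypB (ofFunctor Φ₂ F₂) Ψ)
    (hU : ∀ (A : C₁) (α : Aut A), α ∈ (ofFunctor Φ₁ F₁).unitsSubgroup A →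
      Ψ.functor.mapIso α ∈ (ofFunctor Φ₂ F₂).unitsSubgroup (Ψ.functor.obj A)) :
    PreservesDegFr (ofFunctor Φ₁ F₁) (ofFunctor Φ₂ F₂) Ψ := by
  rcases groupLike_dichotomy_of_isOfFSMType hF₁ hF₂ hs₁.quasiIsotropic hs₂.quasiIsotropic hD₁ hD₂ Ψ with
    ⟨hg₁, hg₂⟩ | ⟨⟨N₁, hN₁⟩, ⟨N₂, hN₂⟩⟩
  · obtain ⟨-, ΨN, hΨN, -⟩ :=
      thm34iii_of_isOfGroupLikeType_of_hypB hF₁ hF₂ hs₁.quasiIsotropic hs₂.quasiIsotropic hg₁ hg₂ Ψ hB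
    exact preservesDegFr_ofFunctor_of_isOfGroupLikeType hF₁ hF₂ Ψ hs₁ hs₂ hB hg₁ hg₂ hU ⟨ΨN, hΨN⟩
  · intro A B φ
    rw [ofFunctor_isGroupLikeObj] at hN₁ hN₂
    exact degFr_map hF₁ hF₂ hs₁.quasiIsotropic hs₂.quasiIsotropic hD₁ hD₂
      (isNonDilatingOn_of_ofFunctor hs₁.nonDilating) (isNonDilatingOn_of_ofFunctor hs₂.nonDilating) Ψ hN₁ hN₂ φ

/-- **The typed `PreFrobenioidData.Thm34iv` (preservation part) over bases of FSM-type, modulo its own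
first two clauses** ("`Ψ` preserves `O^▷(−)` and `O^×(−)`", sub-DAG row `(iv)/L08`, hypothesis `h08` in the
literal shape of the typed conclusion): the third clause `PreservesDegFr` is then a theorem.
[cite: MochizukiFrdI2008, Thm. 3.4 (iv) p.63] -/
theorem thm34iv_ofFunctor_of_isOfFSMType_of_units (hF₁ : PreFrobenioid.IsFrobenioid F₁)
    (hF₂ : PreFrobenioid.IsFrobenioid F₂) (hD₁ : IsOfFSMType D₁) (hD₂ : IsOfFSMType D₂) (Ψ : C₁ ≌ C₂)
    (h08 : (ofFunctor Φ₁ F₁).IsOfStandardType → (ofFunctor Φ₂ F₂).IsOfStandardType →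
      (ofFunctor Φ₁ F₁).HypB (ofFunctor Φ₂ F₂) Ψ → IsFrobeniusSlim D₁ → IsFrobeniusSlim D₂ →
      (∀ (A : C₁) (α : End A), α ∈ (ofFunctor Φ₁ F₁).endSubmonoid A →
          Ψ.functor.map α ∈ (ofFunctor Φ₂ F₂).endSubmonoid (Ψ.functor.obj A)) ∧
        ∀ (A : C₁) (α : Aut A), α ∈ (ofFunctor Φ₁ F₁).unitsSubgroup A →
          Ψ.functor.mapIso α ∈ (ofFunctor Φ₂ F₂).unitsSubgroup (Ψ.functor.obj A)) :
    (ofFunctor Φ₁ F₁).Thm34iv (ofFunctor Φ₂ F₂) Ψ := fun hs₁ hs₂ hB hsl₁ hsl₂ =>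
  ⟨(h08 hs₁ hs₂ hB hsl₁ hsl₂).1, (h08 hs₁ hs₂ hB hsl₁ hsl₂).2,
    preservesDegFr_ofFunctor_of_isOfFSMType hF₁ hF₂ hD₁ hD₂ Ψ hs₁ hs₂ hB (h08 hs₁ hs₂ hB hsl₁ hsl₂).2⟩

end FrdI

end Literature.AlgebraicGeometry.Frobenioids
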